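import Summits.QuantumFields.YangMills.Theorems.SwapVirialDeficitNearFlatBridge
import Summits.QuantumFields.YangMills.Theorems.SwapVirialDeficitBlowUpGnomonicSeamCommutatorFloor
import HarnessLib

/-!
# THE RELATION SIZES IN QUATERNION NORM: commutators and σ-residuals of a leader-chart configuration are `≤ 60L³·√(F/2)`, followers `≤ 48L³·√(F/2)` off `1`
# (free-hands support of ⟨stmt-QuantumFields-24197⟩ `SwapVirialDeficit.SwapGluedStiffness`; the input side of the near-flat projection ASSEMBLY of LEAD g98/g99's plan of record
# memo7 §C(c): ✓`chartBox_of_chartDeficit` (Frobenius) read through ✓`fd_sq_eq_two_mul` (`frobNorm(U − V) = √2·‖su2Quat U − su2Quat V‖`))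

* `norm_su2Quat_sub_eq` (`‖su2Quat U − su2Quat V‖ = frobNorm(U − V)/√2`), `norm_su2Quat_comm_eq`;
* ★★ `relations_le_of_chartDeficit (q)`: with `Ĉ_k := su2Quat (q.1 k)`, `F := chartDeficit L 0 1 q`:
  `‖Ĉ_μ Ĉ_ν − Ĉ_ν Ĉ_μ‖ ≤ 60L³√F/√2` (`μ, ν ∈ Fin 3`), `‖Ĉ₃ Ĉ_{σμ} − Ĉ_μ Ĉ₃‖ ≤ 60L³√F/√2`, `‖su2Quat (q.2 i) − 1‖ ≤ 48L³√F/√2`.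

HONEST LABEL: bookkeeping on landed inequalities; stubs of ➎, ⟨24197⟩ ∕ ⟨24194⟩ ∕ ⟨24497⟩ OPEN; own crux ⟨22884⟩ OPEN (blocked-on ⟨19935⟩); the Yang–Mills mass gap is NOT proved; no summit
is proved by a line.  THEOREMS ONLY (0 `def`, 0 `sorry`), standard axioms.  Width seat ym-line-sfw-p2-w3 g66 (cell ym-idea-1, free hands), `--supports stmt-QuantumFields-24197`.
References: [cite: MontvayMunster1994, §3.2.3 (3.97)]; [folklore].
-/

set_option autoImplicit false

noncomputable section

open Quaternion
open scoped Quaternion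
open Literature.MathematicalPhysics.QuantumFieldTheory hiding SU2
open Literature.MathematicalPhysics.QuantumLattice

namespace Summit.QuantumFields.YangMills.Theorems.SwapVirialDeficit.NearFlat

open Summit.QuantumFields.YangMills.Theorems.FemtoTransferGap
open Summit.QuantumFields.YangMills.Theorems.FemtoTransferGap.TT
open Summit.QuantumFields.YangMills.Theorems.FemtoTransferGap.TwoLattice.Flat (fd)
open Summit.QuantumFields.YangMills.Theorems.VirialFluxGap.RingDeficit
open Summit.QuantumFields.YangMills.Theorems.SwapVirialDeficit.SwapRing
open Summit.QuantumFields.YangMills.Theorems.SwapVirialDeficit.BlowUpRing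
open Summit.QuantumFields.YangMills.Theorems.ToronValleyVolume.Lojasiewicz (fd_sq_eq_two_mul)

variable {L : ℕ} [NeZero L]

omit [NeZero L] in
/-- `‖su2Quat U − su2Quat V‖ = frobNorm(U − V)/√2`. [cite: MontvayMunster1994, §3.2.3 (3.97)] -/
theorem norm_su2Quat_sub_eq (U V : SU2) :
    ‖su2Quat U - su2Quat V‖ = frobNorm (((U : SU2) : Matrix (Fin 2) (Fin 2) ℂ) - ((V : SU2) : Matrix (Fin 2) (Fin 2) ℂ)) / Real.sqrt 2 := by
  have h := fd_sq_eq_two_mul U V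
  have hfd : fd U V = frobNorm (((U : SU2) : Matrix (Fin 2) (Fin 2) ℂ) - ((V : SU2) : Matrix (Fin 2) (Fin 2) ℂ)) := rfl
  rw [← hfd]
  have h0 : 0 ≤ fd U V := frobNorm_nonneg _
  have h1 : 0 ≤ ‖su2Quat U - su2Quat V‖ := norm_nonneg _
  have hs : Real.sqrt 2 * ‖su2Quat U - su2Quat V‖ = fd U V := by
    have h2 : (Real.sqrt 2 * ‖su2Quat U - su2Quat V‖) ^ 2 = fd U V ^ 2 := by rw [mul_pow, Real.sq_sqrt (by norm_num), h]
    have h3 : 0 ≤ Real.sqrt 2 * ‖su2Quat U - su2Quat V‖ := by positivity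
    nlinarith [h2, h3, h0, sq_nonneg (Real.sqrt 2 * ‖su2Quat U - su2Quat V‖ - fd U V), sq_nonneg (Real.sqrt 2 * ‖su2Quat U - su2Quat V‖ + fd U V)]
  rw [← hs]
  have : (0 : ℝ) < Real.sqrt 2 := by positivity
  field_simp

omit [NeZero L] in
/-- Commutators: `‖su2Quat U·su2Quat V − su2Quat V·su2Quat U‖ = frobNorm(UV − VU)/√2`. [folklore] -/
theorem norm_su2Quat_comm_eq (U V : SU2) :
    ‖su2Quat U * su2Quat V - su2Quat V * su2Quat U‖ = frobNorm (((U * V : SU2) : Matrix (Fin 2) (Fin 2) ℂ) - ((V * U : SU2) : Matrix (Fin 2) (Fin 2) ℂ)) / Real.sqrt 2 := by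
  rw [← Balaban1983to89.T4HaarSU2Translate.su2Quat_mul, ← Balaban1983to89.T4HaarSU2Translate.su2Quat_mul]
  exact norm_su2Quat_sub_eq (U * V) (V * U)

/-- ★★ **THE RELATION SIZES IN QUATERNION NORM** (principal sector, character `1`): pairwise commutators of `C₀,C₁,C₂`, the three σ-residuals `Ĉ₃Ĉ_{σμ} − Ĉ_μĈ₃`, and the followers'
distance to `1` are bounded by `60L³√F/√2`, `60L³√F/√2`, `48L³√F/√2`. [cite: Luscher1983, §2] -/
theorem relations_le_of_chartDeficit (q : (Fin 4 → SU2) × (Fol L → SU2)) :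
    (∀ μ ν : Fin 3, ‖su2Quat (q.1 (Fin.castSucc μ)) * su2Quat (q.1 (Fin.castSucc ν)) - su2Quat (q.1 (Fin.castSucc ν)) * su2Quat (q.1 (Fin.castSucc μ))‖ ≤
        60 * (L : ℝ) ^ 3 * Real.sqrt (chartDeficit L (fun _ => false) (fun _ => 1) q) / Real.sqrt 2) ∧
    (∀ μ : Fin 3, ‖su2Quat (q.1 (Fin.last 3)) * su2Quat (q.1 (Fin.castSucc (Equiv.swap (0 : Fin 3) 1 μ))) -
        su2Quat (q.1 (Fin.castSucc μ)) * su2Quat (q.1 (Fin.last 3))‖ ≤ 60 * (L : ℝ) ^ 3 * Real.sqrt (chartDeficit L (fun _ => false) (fun _ => 1) q) / Real.sqrt 2) ∧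
    (∀ i : Fol L, ‖su2Quat (q.2 i) - 1‖ ≤ 48 * (L : ℝ) ^ 3 * Real.sqrt (chartDeficit L (fun _ => false) (fun _ => 1) q) / Real.sqrt 2) := by
  obtain ⟨hc, hσ, hf⟩ := chartBox_of_chartDeficit (L := L) q
  have hs2 : (0 : ℝ) < Real.sqrt 2 := by positivity
  refine ⟨fun μ ν => ?_, fun μ => ?_, fun i => ?_⟩
  · rw [norm_su2Quat_comm_eq]
    exact div_le_div_of_nonneg_right (hc μ ν) hs2.le
  · rw [← Balaban1983to89.T4HaarSU2Translate.su2Quat_mul, ← Balaban1983to89.T4HaarSU2Translate.su2Quat_mul, norm_su2Quat_sub_eq]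
    exact div_le_div_of_nonneg_right (hσ μ) hs2.le
  · have e : (1 : ℍ) = su2Quat (1 : SU2) := by rw [Balaban1983to89.T4HaarSU2Translate.su2Quat_one]
    rw [e, norm_su2Quat_sub_eq]
    refine div_le_div_of_nonneg_right ?_ hs2.le
    have : (((1 : SU2) : SU2) : Matrix (Fin 2) (Fin 2) ℂ) = 1 := rfl
    rw [this]; exact hf i

end Summit.QuantumFields.YangMills.Theorems.SwapVirialDeficit.NearFlat

end
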